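import Summits.QuantumFields.GaugeBoot.TorusPeeling
import HarnessLib

/-!
# Gauge-boot: an UPPER bound for the torus partition function by peeling plaquettes —
# `Z_L(β) ≤ z(β)^{(d−1)(L^d − L^{d−1})}` (supplement 21, part 3c, file 2/2)

HONEST FRAMING (cell `pub-gaugeboot`, page 1 of every file): certified bounds on lattice
expectations at STATED coupling, gauge group, dimension and torus size; NOT a mass gap, NOT a
continuum limit, NOT a string tension, NOT large `N`; NOT Yang–Mills-summit-bearing (barriers
`FixedCouplingUltralocality`, `PerturbativeInvisibility`).  A structural inequality for the Wave-0
torus partition function at `β ≥ 0`; it certifies no number.  Input of the `O(1/β)` bound (part 3e).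

## Content

Continuing file 1/2 (`TorusPeeling`: the assigned links `(x, μ)`, `x₀ ≠ 0`, `μ ≠ 0`, their layers
`x₀ = k`, the peeling map `peelMap k` and the peeled weights `peelWeight k`), for a compact
second-countable `G` and a continuous `ρ` (`f(g) = e^{−β(N − Re tr ρ(g))} ∈ (0, 1]` for `β ≥ 0`):

* `Peel.weight_le_one`, `weight_inv` (`f(g⁻¹) = f(g)`), `continuous_peelWeight`;
* ★ `Peel.peelWeight_comp_peelMap` — peeling layer `k ≥ 1` converts its plaquette weights into
  one-link weights and touches nothing else: `peelWeight k ∘ peelMap k = peelWeight (k−1)`;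
* ★ `Peel.measurePreserving_peelMap` — `peelMap k` preserves `Haar^{⊗E}` (fiberwise right translations,
  `PiFiber.measurePreserving_fiberwise`);
* `Peel.integral_peelWeight_eq` (induction on `k`), `integral_peelWeight_top` (`= z^{#assigned}`,
  `z = ∫_G f dHaar`, a product of independent one-link integrals);
* ★★ `Peel.integral_exp_neg_mul_wilsonAction_le` — **`∫ e^{−βS} dHaar^{⊗E} ≤ z^{#assigned}`** for
  `β ≥ 0`, and ★★ `Peel.torusLogPartition_le` — **`log Z_L(β) ≤ #assigned · log z`** with
  `#assigned = (d−1)(L^d − L^{d−1})` (`Peel.card_assigned`).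

With a one-link Laplace bound `z ≤ C β^{−dim G/2}` (parts 3a–3b for `U(N)`, `SU(N)`) this is the upper
half of the free-energy sandwich whose lower half is axial gauge (part 3d).  [folklore] (inequality form
of the axial-gauge triangular change of variables, e.g. S. Chatterjee, arXiv:1602.01222 §9.)
-/

noncomputable section

open MeasureTheory Filter
open Literature.MathematicalPhysics.QuantumFieldTheory
open Literature.MathematicalPhysics.QuantumLattice (measurePreserving_mul_mul_inv_haarProbability)
open Literature.RepresentationTheory.CompactGroups

namespace Summit.QuantumFields.GaugeBoot

namespace Peel

/-! ### Topology: continuity, `f ≤ 1`, `f(g⁻¹) = f(g)` -/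

section Topology

variable {d L N : ℕ} [NeZero d] {G : Type*} [Group G] [TopologicalSpace G] [IsTopologicalGroup G] [CompactSpace G]
  (ρ : G →* Matrix (Fin N) (Fin N) ℂ)

/-- `f ≤ 1` for `β ≥ 0` (continuous `ρ`: `Re tr ρ ≤ N`). [folklore] -/
theorem weight_le_one (hρ : Continuous ρ) {β : ℝ} (hβ : 0 ≤ β) (g : G) : weight ρ β g ≤ 1 := by
  unfold weight
  rw [Real.exp_le_one_iff]
  have := re_trace_le_of_continuous ρ hρ g
  nlinarith

/-- `f(g⁻¹) = f(g)`. [folklore] -/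
theorem weight_inv (hρ : Continuous ρ) (β : ℝ) (g : G) : weight ρ β g⁻¹ = weight ρ β g := by
  unfold weight; rw [CompactGroup.re_trace_map_inv ρ hρ]

omit [IsTopologicalGroup G] [CompactSpace G] in
/-- `f` is continuous. [folklore] -/
theorem continuous_weight (hρ : Continuous ρ) (β : ℝ) : Continuous (weight ρ β) := by
  unfold weight
  exact Real.continuous_exp.comp (continuous_const.mul (continuous_const.sub
    (Complex.continuous_re.comp hρ.matrix_trace)))

omit [CompactSpace G] in
/-- The peeled weights are continuous. [folklore] -/
theorem continuous_peelWeight [NeZero L] (hρ : Continuous ρ) (β : ℝ) (k : ℕ) :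
    Continuous (peelWeight (d := d) (L := L) (G := G) ρ β k) := by
  unfold peelWeight
  refine continuous_finsetProd _ fun e _ => ?_
  split_ifs
  · exact (continuous_weight ρ hρ β).comp (continuous_apply e)
  · exact (continuous_weight ρ hρ β).comp (by unfold plaquetteHolonomy; fun_prop)

/-- `peelWeight ≤ 1` for `β ≥ 0`. [folklore] -/
theorem peelWeight_le_one [NeZero L] (hρ : Continuous ρ) {β : ℝ} (hβ : 0 ≤ β) (k : ℕ) (U : GaugeConfig d L G) :
    peelWeight ρ β k U ≤ 1 :=
  Finset.prod_le_one (fun e _ => by split_ifs <;> exact (weight_pos ρ β _).le)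
    fun e _ => by split_ifs <;> exact weight_le_one ρ hρ hβ _

/-- ★ **Peeling layer `k` converts its plaquette weights into link weights**:
`peelWeight k ∘ peelMap k = peelWeight (k − 1)` for `k ≥ 1`. [folklore] -/
theorem peelWeight_comp_peelMap [NeZero L] (hρ : Continuous ρ) (β : ℝ) {k : ℕ} (hk : k ≠ 0)
    (U : GaugeConfig d L G) : peelWeight ρ β k (peelMap k U) = peelWeight ρ β (k - 1) U := by
  classical
  unfold peelWeight
  refine Finset.prod_congr rfl fun e he => ?_
  obtain ⟨hx0, hμ⟩ := mem_assigned.1 he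
  rcases Nat.lt_trichotomy ((e.1 0).val) k with hlt | heq | hgt
  · -- already converted: untouched
    have hnot : e ∉ layer d L k := fun h => hlt.ne h.1
    rw [if_pos hlt.le, if_pos (by omega), peelMap_apply_of_not_mem hnot]
  · -- layer `k`: converted now
    have hmem : e ∈ layer d L k := ⟨heq, hμ⟩
    rw [if_pos heq.le, if_neg (by omega), peelMap_apply_of_mem hmem, mul_tailOf, weight_inv ρ hρ]
  · -- later layer: its plaquette does not read layer `k`
    rw [if_neg (by omega), if_neg (by omega)]
    congr 1
    have h1 : (e.1, (0 : Fin d)) ∉ layer d L k := fun h => h.2 rfl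
    have h2 : (e.1.shift 0, e.2) ∉ layer d L k := fun h => val_shift_zero_ne (x := e.1) hk hgt.le h.1
    have h3 : (e.1.shift e.2, (0 : Fin d)) ∉ layer d L k := fun h => h.2 rfl
    have h4 : (e.1, e.2) ∉ layer d L k := fun h => hgt.ne' h.1
    unfold plaquetteHolonomy
    rw [peelMap_apply_of_not_mem h1, peelMap_apply_of_not_mem h2, peelMap_apply_of_not_mem h3,
      peelMap_apply_of_not_mem h4]

end Topology

/-! ### Measure: the peeling maps preserve Haar, and the bound -/

section Measure

variable {d L N : ℕ} [NeZero d] [NeZero L] {G : Type*} [Group G] [TopologicalSpace G] [IsTopologicalGroup G]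
  [CompactSpace G] [MeasurableSpace G] [BorelSpace G] [SecondCountableTopology G]
  (ρ : G →* Matrix (Fin N) (Fin N) ℂ)

/-- ★ **The peeling map preserves the product Haar measure** (`k ≥ 1`). [folklore] -/
theorem measurePreserving_peelMap {k : ℕ} (hk : k ≠ 0) :
    MeasurePreserving (peelMap (d := d) (L := L) (G := G) k)
      (Measure.pi fun _ : Edge d L => haarProbability G) (Measure.pi fun _ : Edge d L => haarProbability G) := by
  classical
  haveI : Nonempty G := ⟨1⟩
  refine PiFiber.measurePreserving_fiberwise (haarProbability G) (layer d L k)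
    (fun U e v => v * tailOf U e) ?_ ?_ ?_
  · -- the multiplier of a layer-`k` link only reads links outside the layer
    intro U U' hUU' e he
    obtain ⟨hx, hμ⟩ := he
    funext v
    have h1 : U (e.1.shift e.2, 0) = U' (e.1.shift e.2, 0) := hUU' _ (fun h => h.2 rfl)
    have h2 : U (e.1.shift 0, e.2) = U' (e.1.shift 0, e.2) :=
      hUU' _ (fun h => val_shift_zero_ne (x := e.1) hk hx.ge h.1)
    have h3 : U (e.1, 0) = U' (e.1, 0) := hUU' _ (fun h => h.2 rfl)
    simp only [tailOf, h1, h2, h3]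
  · refine Continuous.measurable ?_
    refine continuous_pi fun e => ?_
    unfold tailOf
    fun_prop
  · intro U e
    have h := measurePreserving_mul_mul_inv_haarProbability (G := G) (1 : G) (tailOf U e)⁻¹
    simpa only [one_mul, inv_inv] using h

/-- ★ **The integral of the peeled weight does not depend on the number of peeled layers.** [folklore] -/
theorem integral_peelWeight_eq (hρ : Continuous ρ) (β : ℝ) (k : ℕ) :
    ∫ U, peelWeight ρ β k U ∂(Measure.pi fun _ : Edge d L => haarProbability G) =
      ∫ U, peelWeight ρ β 0 U ∂(Measure.pi fun _ : Edge d L => haarProbability G) := by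
  induction k with
  | zero => rfl
  | succ k ih =>
    rw [← ih]
    have hmp := measurePreserving_peelMap (d := d) (L := L) (G := G) (k := k + 1) (Nat.succ_ne_zero k)
    have hcomp : ∫ U, peelWeight ρ β (k + 1) (peelMap (k + 1) U) ∂(Measure.pi fun _ : Edge d L => haarProbability G) =
        ∫ U, peelWeight ρ β (k + 1) U ∂(Measure.pi fun _ : Edge d L => haarProbability G) := by
      rw [← integral_map hmp.measurable.aemeasurable
        ((continuous_peelWeight ρ hρ β (k + 1)).measurable.aestronglyMeasurable), hmp.map_eq]
    rw [← hcomp]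
    refine integral_congr_ae (ae_of_all _ fun U => ?_)
    show peelWeight ρ β (k + 1) (peelMap (k + 1) U) = peelWeight ρ β k U
    rw [peelWeight_comp_peelMap ρ hρ β (Nat.succ_ne_zero k)]
    rfl

omit [SecondCountableTopology G] in
/-- The fully peeled weight integrates to `z^{#assigned}`, `z = ∫_G f dHaar`. [folklore] -/
theorem integral_peelWeight_top (β : ℝ) :
    ∫ U, peelWeight ρ β L U ∂(Measure.pi fun _ : Edge d L => haarProbability G) =
      (∫ g, weight ρ β g ∂(haarProbability G)) ^ (assigned d L).card := by
  classical
  have hfun : (fun U : GaugeConfig d L G => peelWeight ρ β L U) =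
      fun U => ∏ e : Edge d L, (if e ∈ assigned d L then weight ρ β (U e) else 1) := by
    funext U
    rw [peelWeight_top, Finset.prod_ite_mem, Finset.univ_inter]
  rw [hfun, integral_fintype_prod_eq_prod (f := fun (e : Edge d L) (v : G) => if e ∈ assigned d L then weight ρ β v else 1)]
  have hint : ∀ e : Edge d L, ∫ v, (if e ∈ assigned d L then weight ρ β v else 1) ∂(haarProbability G) =
      if e ∈ assigned d L then ∫ g, weight ρ β g ∂(haarProbability G) else 1 := by
    intro e
    split_ifs
    · rfl
    · simp
  simp_rw [hint]
  rw [Finset.prod_ite_mem, Finset.univ_inter, Finset.prod_const]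

/-- ★★ **The peeling bound**: for `β ≥ 0`,
`∫ e^{−βS} dHaar^{⊗E} ≤ (∫_G e^{−β(N − Re tr ρ)} dHaar)^{#assigned}`. [folklore] -/
theorem integral_exp_neg_mul_wilsonAction_le (hρ : Continuous ρ) {β : ℝ} (hβ : 0 ≤ β) :
    ∫ U, Real.exp (-β * wilsonAction ρ U) ∂(Measure.pi fun _ : Edge d L => haarProbability G) ≤
      (∫ g, weight ρ β g ∂(haarProbability G)) ^ (assigned d L).card := by
  rw [← integral_peelWeight_top ρ β, integral_peelWeight_eq ρ hρ β L]
  refine integral_mono (integrable_exp_mul_wilsonAction ρ hρ _ _) ?_ fun U =>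
    exp_neg_mul_wilsonAction_le_peelWeight_zero ρ (weight_le_one ρ hρ hβ) U
  exact Integrable.of_bound (continuous_peelWeight ρ hρ β 0).measurable.aestronglyMeasurable 1
    (ae_of_all _ fun U => by
      rw [Real.norm_eq_abs, abs_of_nonneg (peelWeight_nonneg ρ β 0 U)]
      exact peelWeight_le_one ρ hρ hβ 0 U)

omit [MeasurableSpace G] [BorelSpace G] [SecondCountableTopology G] in
/-- Two-sided bounds for the weight: `e^{−2N|β|} ≤ f ≤ e^{2N|β|}`. [folklore] -/
theorem weight_mem_Icc (hρ : Continuous ρ) (β : ℝ) (g : G) :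
    weight ρ β g ∈ Set.Icc (Real.exp (-(|β| * (2 * N)))) (Real.exp (|β| * (2 * N))) := by
  have h1 := re_trace_le_of_continuous ρ hρ g
  have h2 : -(N : ℝ) ≤ (ρ g).trace.re := by
    have h := CompactGroup.abs_re_trace_le_card ρ hρ g
    rw [Fintype.card_fin] at h
    exact (abs_le.1 h).1
  have h3 : 0 ≤ (N : ℝ) - (ρ g).trace.re := by linarith
  have h4 : (N : ℝ) - (ρ g).trace.re ≤ 2 * N := by linarith
  unfold weight
  constructor <;> rw [Real.exp_le_exp] <;> nlinarith [abs_nonneg β, neg_abs_le β, le_abs_self β]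

omit [SecondCountableTopology G] in
/-- The weight is integrable. [folklore] -/
theorem integrable_weight (hρ : Continuous ρ) (β : ℝ) : Integrable (weight ρ β) (haarProbability G) :=
  Integrable.of_bound (continuous_weight ρ hρ β).measurable.aestronglyMeasurable (Real.exp (|β| * (2 * N)))
    (ae_of_all _ fun g => by
      rw [Real.norm_eq_abs, abs_of_nonneg (weight_pos ρ β g).le]
      exact (weight_mem_Icc ρ hρ β g).2)

omit [SecondCountableTopology G] in
/-- The one-link integral is positive. [folklore] -/
theorem integral_weight_pos (hρ : Continuous ρ) (β : ℝ) : 0 < ∫ g, weight ρ β g ∂(haarProbability G) := by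
  calc (0 : ℝ) < Real.exp (-(|β| * (2 * N))) := Real.exp_pos _
    _ = ∫ _g, Real.exp (-(|β| * (2 * N))) ∂(haarProbability G) := by simp
    _ ≤ ∫ g, weight ρ β g ∂(haarProbability G) :=
        integral_mono (integrable_const _) (integrable_weight ρ hρ β) fun g => (weight_mem_Icc ρ hρ β g).1

/-- ★★ **The torus free energy is bounded by one-link integrals**: for `β ≥ 0`,
`log Z_L(β) ≤ #assigned · log ∫_G e^{−β(N − Re tr ρ)} dHaar`, `#assigned = (d−1)(L^d − L^{d−1})`
(`Peel.card_assigned`). [folklore] -/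
theorem torusLogPartition_le (hρ : Continuous ρ) {β : ℝ} (hβ : 0 ≤ β) :
    Literature.MathematicalPhysics.QuantumLattice.torusLogPartition d ρ β L ≤
      (assigned d L).card * Real.log (∫ g, weight ρ β g ∂(haarProbability G)) := by
  rw [Literature.MathematicalPhysics.QuantumFieldTheory.torusLogPartition_eq_log_integral ρ hρ, ← Real.log_pow]
  exact Real.log_le_log (integral_exp_neg_mul_wilsonAction_pos ρ hρ β)
    (integral_exp_neg_mul_wilsonAction_le ρ hρ hβ)

end Measure

end Peel

end Summit.QuantumFields.GaugeBoot

end
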